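import Literature.NumberTheory.PAdicHodge.BmaxPlusTRegular
import Literature.NumberTheory.PAdicHodge.BdRPlusDVR
import HarnessLib

/-!
# `t = log[ε]` is divisible by `p` in `A_max`: `t/p ∈ (A_max)^{φ=p} ∩ ker θ` and `t/p ∉ t·A_max`

Topic `Literature/NumberTheory/PAdicHodge`; namespace `Literature.NumberTheory.PAdicHodge`. THEOREMS ONLY (no definition, no named
fact, no instance, no `sorry`). In Colmez's integral crystalline ring `A_max = B_max⁺(F)` (`BmaxPlus`), Fontaine's
`t = Σ_{k≥1} (−1)^{k+1} u^k/k` (`u = [ε] − 1`, `tBmax`) is DIVISIBLE BY `p`: every term `u^k/k = c_k·w^k·(ξ/p)^k` has `c_k = p^k/k ∈ pℤ_p`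
(equivalently `u ∈ (p, ξ)𝔸_inf ⊂ p·A_max`, as `v(ε − 1) = p/(p−1) ≥ 1`). Consequences:

* `logTerm_mem_span_natCast`, `logSum_mem_span_natCast` — the partial sums lie in `p·B⁰_max`;
* ★ `exists_tBmax_eq_natCast_mul` — **`t = p·t'`** for some `t' ∈ A_max` (`evalₐ_eq_zero_iff` of `PrincipalCompletion`);
* `frobBmaxPlus_eq_of_tBmax_eq_natCast_mul`, `thetaBmaxPlus_eq_zero_of_tBmax_eq_natCast_mul` — **any such `t'` is a `φ = p` eigenvector
  in `ker θ`**; `not_isUnit_natCast_bmaxPlus` (`p ∉ A_maxˣ`) and ★ `not_tBmax_dvd_of_tBmax_eq_natCast_mul` — **`t ∤ t'`**.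

So in the `t`-divisibility statement (TDIV) «`φx = px ∧ θx = 0 ⇒ ∃ k q, p^k x = t q`» of brick B7 of the φ-road of line `kato_lever`
(crux K★ `stmt-BirchSwinnertonDyer-22226`, `BmaxPlusFontaineKernel`: Fontaine's lemma ⟸ (TDIV)) the exponent `k = 0` is IMPOSSIBLE: the
sharp form is `(A_max)^{φ=p} ∩ ker θ = ℤ_p · t/p` (memo `Cruxes/StarredOptimalManinUnitFiveSeven/Lines/kato-lever-K2-fontaine-lemma-g24.md` §1).
Infrastructure only: BSD / K★ are not proved by any of this.

## References
* [Colmez1998Annals] P. Colmez, *Théorie d'Iwasawa des représentations de de Rham d'un corps local*, Ann. of Math. 148 (1998), §III.2–III.3.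
* [FontaineAsterisque223III] J.-M. Fontaine, *Le corps des périodes p-adiques*, Astérisque 223 (1994), Exp. II §1.5.4, Exp. III §5.3.
* [BergerLaurent2002] L. Berger, *Représentations p-adiques et équations différentielles*, Invent. Math. 148 (2002), §1.2.
-/

noncomputable section

open WittVector Field ValuativeRel Finset
open Literature.AlgebraicGeometry.Resolution

namespace Literature.NumberTheory.PAdicHodge

open Literature.NumberTheory.GaloisRepresentations
open Literature.NumberTheory.GaloisRepresentations.IsNonarchimedeanLocalField

variable {F : Type} [Field F] [ValuativeRel F] [TopologicalSpace F] [IsNonarchimedeanLocalField F]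
  [CharZero F] {p : ℕ} [Fact p.Prime] [Fact (¬ IsUnit (p : integerC F))]
  [IsAdicComplete (Ideal.span {(p : integerC F)}) (integerC F)]

/-! ### §1 The partial sums of `t` lie in `p·B⁰_max` -/

/-- **`u^k/k ∈ p·B⁰_max` for every `k ≥ 1`** (`c_k = p^k/k ∈ pℤ_p`: `k = 1` gives `c_1 = p`, and `c_k ∈ pℤ_p` for `k ≥ 2` by
`exists_logCoeff_eq_pow_mul`). [cite: BergerLaurent2002, §1.2] -/
theorem logTerm_mem_span_natCast {k : ℕ} (hk : k ≠ 0) :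
    logTerm (F := F) (p := p) k ∈ Ideal.span {(p : bmaxZero F p)} := by
  by_cases h2 : 2 ≤ k
  · have h := logTerm_mem_span_pow (F := F) (p := p) hk (m := 1) (by omega)
    rwa [pow_one] at h
  · have hk1 : k = 1 := by omega
    subst hk1
    have hc : logCoeff p 1 = (p : ℤ_[p]) := by
      have h := natCast_mul_logCoeff (p := p) one_ne_zero
      rwa [Nat.cast_one, one_mul, pow_one] at h
    rw [Ideal.mem_span_singleton']
    refine ⟨algebraMap (Ainf (p := p) F) (bmaxZero F p) uDivXi * omegaB, ?_⟩
    rw [logTerm, hc, map_natCast, pow_one, pow_one, map_mul, map_natCast]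
    ring

/-- **`logSum N ∈ p·B⁰_max`** for every `N`. [cite: BergerLaurent2002, §1.2] -/
theorem logSum_mem_span_natCast (N : ℕ) : logSum (F := F) (p := p) N ∈ Ideal.span {(p : bmaxZero F p)} := by
  rw [logSum]
  exact Ideal.sum_mem _ fun k _ => logTerm_mem_span_natCast (Nat.succ_ne_zero k)

/-! ### §2 `t = p·t'` in `A_max` -/

set_option maxHeartbeats 1600000 in
/-- ★ **`t = log[ε]` is divisible by `p` in `A_max`**: `t = p · t'` for some `t' ∈ A_max` (`t mod p = logSum(p − 1) mod p = 0`).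
[cite: Colmez1998Annals, §III.2] [cite: FontaineAsterisque223III, Exp. II §1.5.4] -/
theorem exists_tBmax_eq_natCast_mul : ∃ t' : BmaxPlus F p, tBmax (F := F) (p := p) = (p : BmaxPlus F p) * t' := by
  have h1 : AdicCompletion.evalₐ (Ideal.span {(p : bmaxZero F p)}) 1 (tBmax (F := F) (p := p)) = 0 := by
    rw [evalₐ_tBmax, Ideal.Quotient.eq_zero_iff_mem, pow_one]
    exact logSum_mem_span_natCast _
  obtain ⟨y, hy⟩ := (PrincipalCompletion.evalₐ_eq_zero_iff (I := Ideal.span {(p : bmaxZero F p)}) rfl _ 1).1 h1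
  refine ⟨y, ?_⟩
  have hp : PrincipalCompletion.xiHat (Ideal.span {(p : bmaxZero F p)}) (p : bmaxZero F p) = (p : BmaxPlus F p) :=
    map_natCast (algebraMap (bmaxZero F p) (BmaxPlus F p)) p
  rw [hy, pow_one, hp]

/-- **Any `t'` with `t = p t'` is a `φ = p` eigenvector** (`φt = pt` and `p` is a non-zero-divisor on `A_max`). [cite: Colmez1998Annals, §III.3] -/
theorem frobBmaxPlus_eq_of_tBmax_eq_natCast_mul (hF : Function.Surjective (fontaineTheta (integerC F) p)) {t' : BmaxPlus F p}
    (ht : tBmax (F := F) (p := p) = (p : BmaxPlus F p) * t') : frobBmaxPlus F p t' = (p : BmaxPlus F p) * t' := by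
  have h := frobBmaxPlus_tBmax (F := F) (p := p)
  rw [ht, map_mul, map_natCast, map_natCast] at h
  refine sub_eq_zero.1 (eq_zero_of_natCast_mul_eq_zero' hF ?_)
  rw [mul_sub]
  exact sub_eq_zero.2 h

/-- **Any `t'` with `t = p t'` lies in `ker θ`** (`θ(t) = 0`, `𝒪_{ℂ_F}` is `p`-torsion free). [cite: Colmez1998Annals, §III.3] -/
theorem thetaBmaxPlus_eq_zero_of_tBmax_eq_natCast_mul {t' : BmaxPlus F p} (ht : tBmax (F := F) (p := p) = (p : BmaxPlus F p) * t') :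
    thetaBmaxPlus F p t' = 0 := by
  have h := thetaBmaxPlus_tBmax (F := F) (p := p)
  rw [ht, map_mul, map_natCast] at h
  exact (mul_eq_zero.1 h).resolve_left (natCast_integerC_ne_zero (F := F) (Fact.out : p.Prime).ne_zero)

/-! ### §3 `t ∤ t'`: the exponent in (TDIV) is at least `1` -/

set_option maxHeartbeats 1600000 in
/-- **`p` is not a unit of `A_max`** (`p·B⁰_max ≠ B⁰_max`: `θ(B⁰_max) = 𝒪_{ℂ_F} ∌ p⁻¹`). [cite: Colmez1998Annals, §III.2] -/
theorem not_isUnit_natCast_bmaxPlus (hF : Function.Surjective (fontaineTheta (integerC F) p)) : ¬ IsUnit (p : BmaxPlus F p) := by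
  rintro ⟨v, hv⟩
  -- at level `1`: `p · v⁻¹ ≡ 1`, so `1 ∈ p·B⁰_max`
  have h1 : AdicCompletion.evalₐ (Ideal.span {(p : bmaxZero F p)}) 1 ((p : BmaxPlus F p) * ↑v⁻¹) = 1 := by
    rw [← hv, Units.mul_inv, map_one]
  obtain ⟨y, hy⟩ := Ideal.Quotient.mk_surjective (AdicCompletion.evalₐ (Ideal.span {(p : bmaxZero F p)}) 1 (↑v⁻¹ : BmaxPlus F p))
  rw [map_mul, map_natCast, ← hy, ← map_natCast (Ideal.Quotient.mk (Ideal.span {(p : bmaxZero F p)} ^ 1)), ← map_mul,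
    ← (Ideal.Quotient.mk (Ideal.span {(p : bmaxZero F p)} ^ 1)).map_one, Ideal.Quotient.eq, pow_one] at h1
  have h2 : (1 : bmaxZero F p) ∈ Ideal.span {(p : bmaxZero F p)} := by
    have h3 : (p : bmaxZero F p) * y ∈ Ideal.span {(p : bmaxZero F p)} := Ideal.mul_mem_right _ _ (Ideal.mem_span_singleton_self _)
    have e : (1 : bmaxZero F p) = (p : bmaxZero F p) * y - ((p : bmaxZero F p) * y - 1) := by ring
    rw [e]; exact Ideal.sub_mem _ h3 h1
  exact span_natCast_bmaxZero_ne_top hF ((Ideal.eq_top_iff_one _).2 h2)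

set_option maxHeartbeats 1600000 in
/-- ★ **`t ∤ t'` for `t = p t'`**: otherwise `t (1 − p q) = 0`, `t` regular, and `p` would be a unit of `A_max`. So in (TDIV) the exponent
`k = 0` is impossible; the sharp statement is `(A_max)^{φ=p} ∩ ker θ = ℤ_p · t/p`. [cite: Colmez1998Annals, §III.3]
[cite: FontaineAsterisque223III, Exp. III §5.3] -/
theorem not_tBmax_dvd_of_tBmax_eq_natCast_mul (hF : Function.Surjective (fontaineTheta (integerC F) p)) {t' : BmaxPlus F p}
    (ht : tBmax (F := F) (p := p) = (p : BmaxPlus F p) * t') : ¬ (tBmax (F := F) (p := p) ∣ t') := by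
  rintro ⟨q, hq⟩
  have h1 : tBmax (F := F) (p := p) * (1 - (p : BmaxPlus F p) * q) = 0 := by
    have e : tBmax (F := F) (p := p) * (1 - (p : BmaxPlus F p) * q) = tBmax - (p : BmaxPlus F p) * (tBmax * q) := by ring
    rw [e, ← hq, ← ht, sub_self]
  have h2 := eq_zero_of_tBmax_mul_eq_zero hF h1
  exact not_isUnit_natCast_bmaxPlus hF (IsUnit.of_mul_eq_one q (sub_eq_zero.1 h2).symm)

end Literature.NumberTheory.PAdicHodge

end
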